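import Summits.Ventures.CertifiedQuantumChemistry.Rows.OrbitalRotationHamiltonian
import Summits.Ventures.CertifiedQuantumChemistry.Rows.OrbitalRotationInvariance
import Summits.HubbardSuperconductivity.HubbardSuperconductivity.Theorems.WidthHaldaneFreeFloor
import Summits.HubbardSuperconductivity.HubbardSuperconductivity.Theorems.ColourTheSpinSgEndpointSpinDescent
import Mathlib.LinearAlgebra.Matrix.Charpoly.Basic
import HarnessLib

/-!
# Ventures/CertifiedQuantumChemistry — Rows/OrbitalRotationExactInvariance.lean: the EXACT energies
# `E₀(Ĥ; N)` and `E₀(Ĥ; N_α, N_β)` are orbital-rotation invariants of the integral tables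

HONEST FRAMING (verbatim): certified bounds for a stated model Hamiltonian in a stated basis; not a
claim about the real molecule beyond that model.

Seat rdm-B, ROWS courtesy file (theorems only; no `def`, no notation); consequences of the operator
identity `Γ(Ū)† Ĥ(h, g, h_nuc) Γ(Ū) = Ĥ(h', g', h_nuc)` of `Rows/OrbitalRotationHamiltonian.lean`
(rotated tables `h'_{ab} = Σ_{pq} u_{pa} ū_{qb} h_{pq}`, `g'_{abcd} = Σ_{pqrs} u_{pa} ū_{qb} u_{rc} ū_{sd} g_{pqrs}`,
`U` the spin-free lift of the unitary `u`, `Ū = U.map star`). This closes the item "NOT here: the exact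
side `E₀(Ĥ(h', g')) = E₀(Ĥ(h, g))` (Bogoliubov lift on the Fock space)" of
`Rows/OrbitalRotationInvariance.lean`:

* `charpoly_molecularHamiltonian_conj_orbital` — ISOSPECTRALITY: `Ĥ(h', g', h_nuc)` and
  `Ĥ(h, g, h_nuc)` have the same characteristic polynomial;
* `molecularHamiltonian_mulVec_Gamma_eq_smul_iff` — eigenvectors transport: `Ĥ(h', g')ψ = Eψ` iff
  `Ĥ(h, g) Γ(Ū)ψ = E Γ(Ū)ψ`;
* `commute_Gamma_molecularHamiltonian_of_conj_orbital_eq` — if `u` is a SYMMETRY of the tables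
  (`h' = h`, `g' = g`) then `Γ(Ū)` commutes with `Ĥ(h, g, h_nuc)` (exact-level symmetry blocking);
* `groundEnergy_conjTranspose_Gamma_mul` (any unitary `V` of the spin orbitals: `Γ(V)` preserves `N̂`),
  **`groundEnergy_conj_orbital`**: `E₀(Ĥ(h', g', h_nuc); N) = E₀(Ĥ(h, g, h_nuc); N)`;
* `sectorGroundEnergy_conjTranspose_Gamma_mul` (any SPIN-DIAGONAL unitary `V`: `Γ(V)` preserves the
  `(N_α, N_β)` sectors — tree `preservesSectors_Gamma`), **`sectorGroundEnergy_conj_orbital`**: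
  `E₀(Ĥ(h', g', h_nuc); N_α, N_β) = E₀(Ĥ(h, g, h_nuc); N_α, N_β)`;
* `sectorGroundEnergy_sub_pqgSectorEnergy_conj_orbital` — with `pqgSectorEnergy_conj_orbital`
  (`Rows/OrbitalRotationInvariance.lean`): the SLACK `E₀ − E_PQG` of the sector DQG bound is an
  orbital-rotation invariant — the quality of a certified lower bound of a sector row does not depend
  on the orbital basis (canonical / localised / symmetry-adapted) in which the model file is written.

READING: statements about the ABSTRACT model Hamiltonian and its exact / relaxed optimal values
(Tasaki §2.2 variational characterisation); no certificate sentence, no row / hint / claim node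
depends on them. Everything is PROVED (0 sorry, standard axioms); no definitions, no named facts.

References: T. Helgaker, P. Jørgensen, J. Olsen, *Molecular Electronic-Structure Theory* (Wiley 2000)
§3.2; H. Tasaki, *Physics and Mathematics of Quantum Many-Body Systems* (Springer 2020) §2.2;
O. Bratteli, D. W. Robinson, *Operator Algebras and Quantum Statistical Mechanics 2* (1997) §5.2.1.

Tree (REUSED): `conjTranspose_Gamma_mul_molecularHamiltonian_mul_Gamma`, `mapStar_mem_unitaryGroup`,
`conjTranspose_Gamma_mul_Gamma`, `Gamma_mul_conjTranspose_Gamma` (`Rows/OrbitalRotationHamiltonian`);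
`pqgSectorEnergy_conj_orbital` (`Rows/OrbitalRotationInvariance`); `spin_sel_of_orbital`
(`Rows/OrbitalRotationEnergy`); `preservesSectors_Gamma`, `preservesSectors_Gamma_conjTranspose`
(`Summits/HubbardSuperconductivity/HubbardSuperconductivity/Theorems/WidthHaldaneFreeFloor`);
`isNParticle_Gamma_mulVec` (`…/Theorems/ColourTheSpinSgEndpointSpinDescent`);
`Matrix.minEnergyOn_conjTranspose_mul_mul` (`QuantumLattice.MagneticHubbardTorusGauge`);
`groundEnergy_eq_minEnergyOn` (`QuantumLattice.FinDimSpectrum`); `mem_szSector_iff_isInSector`,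
`PreservesSectors.isInSector_mulVec`, `sectorGroundEnergy_def`. Mathlib: `Matrix.charpoly_mul_comm`.
-/

noncomputable section

namespace Summit.Ventures.CertifiedQuantumChemistry

open Matrix Finset
open Literature.MathematicalPhysics.QuantumLattice Literature.MathematicalPhysics.QuantumChemistry
open scoped ComplexOrder Kronecker

/-! ## §4 Consequences: isospectrality, eigenvector transport, invariance of the exact energies -/

section Consequences

variable {Λ : Type*} [LinearOrder Λ] [Fintype Λ]

/-- **ISOSPECTRALITY**: `Ĥ(h', g', h_nuc)` and `Ĥ(h, g, h_nuc)` have the same characteristic polynomial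
(hence the same spectrum with multiplicities) — they are unitarily equivalent by `Γ(Ū)`. -/
theorem charpoly_molecularHamiltonian_conj_orbital {U : Matrix (Orb Λ) (Orb Λ) ℂ} {u : Matrix Λ Λ ℂ}
    (hU : U * Uᴴ = 1) (hUu : ∀ p q σ τ, U (orb p σ) (orb q τ) = if σ = τ then u p q else 0)
    (h : Λ → Λ → ℂ) (g : Λ → Λ → Λ → Λ → ℂ) (hnuc : ℂ) :
    (molecularHamiltonian (fun a b => ∑ p, ∑ q, u p a * star (u q b) * h p q)
        (fun a b c d => ∑ p, ∑ q, ∑ r, ∑ s, u p a * star (u q b) * u r c * star (u s d) * g p q r s)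
        hnuc).charpoly = (molecularHamiltonian h g hnuc).charpoly := by
  rw [← conjTranspose_Gamma_mul_molecularHamiltonian_mul_Gamma hU hUu, Matrix.mul_assoc,
    Matrix.charpoly_mul_comm, Matrix.mul_assoc,
    Gamma_mul_conjTranspose_Gamma (mapStar_mem_unitaryGroup hU), Matrix.mul_one]

/-- **EIGENVECTOR TRANSPORT**: `ψ` is an eigenvector of `Ĥ(h', g', h_nuc)` with eigenvalue `E` iff the
rotated state `Γ(Ū)ψ` is an eigenvector of `Ĥ(h, g, h_nuc)` with the same eigenvalue (full-CI
eigenpairs of two orbital bases correspond under the Bogoliubov lift). -/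
theorem molecularHamiltonian_mulVec_Gamma_eq_smul_iff {U : Matrix (Orb Λ) (Orb Λ) ℂ} {u : Matrix Λ Λ ℂ}
    (hU : U * Uᴴ = 1) (hUu : ∀ p q σ τ, U (orb p σ) (orb q τ) = if σ = τ then u p q else 0)
    (h : Λ → Λ → ℂ) (g : Λ → Λ → Λ → Λ → ℂ) (hnuc : ℂ) (ψ : Fock (Orb Λ)) (E : ℂ) :
    molecularHamiltonian h g hnuc *ᵥ (Gamma (U.map star) *ᵥ ψ) = E • (Gamma (U.map star) *ᵥ ψ) ↔
      molecularHamiltonian (fun a b => ∑ p, ∑ q, u p a * star (u q b) * h p q)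
          (fun a b c d => ∑ p, ∑ q, ∑ r, ∑ s, u p a * star (u q b) * u r c * star (u s d) * g p q r s)
          hnuc *ᵥ ψ = E • ψ := by
  have hW := mapStar_mem_unitaryGroup hU
  have h1 := conjTranspose_Gamma_mul_Gamma hW
  have h2 := Gamma_mul_conjTranspose_Gamma hW
  rw [← conjTranspose_Gamma_mul_molecularHamiltonian_mul_Gamma hU hUu]
  constructor
  · intro hE
    rw [← mulVec_mulVec, ← mulVec_mulVec, hE, mulVec_smul, mulVec_mulVec, h1, one_mulVec]
  · intro hE
    have hE' := congrArg (fun φ => Gamma (U.map star) *ᵥ φ) hE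
    simp only [mulVec_mulVec, mulVec_smul] at hE'
    rwa [← Matrix.mul_assoc, ← Matrix.mul_assoc, h2, Matrix.one_mul, ← mulVec_mulVec] at hE'

/-- **A SYMMETRY OF THE INTEGRAL TABLES IS IMPLEMENTED BY A UNITARY COMMUTING WITH `Ĥ`.** If the
rotated tables of the unitary `u` coincide with `(h, g)` — `u` is a symmetry of the MODEL (a point-group
operation written in the orbital basis, an orbital permutation, an orbital sign pattern) — then `Γ(Ū)`
commutes with `Ĥ(h, g, h_nuc)`: the exact-level licence for blocking the full-CI problem by the
symmetry (Helgaker–Jørgensen–Olsen §3.2). -/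
theorem commute_Gamma_molecularHamiltonian_of_conj_orbital_eq {U : Matrix (Orb Λ) (Orb Λ) ℂ}
    {u : Matrix Λ Λ ℂ} (hU : U * Uᴴ = 1)
    (hUu : ∀ p q σ τ, U (orb p σ) (orb q τ) = if σ = τ then u p q else 0) {h : Λ → Λ → ℂ}
    {g : Λ → Λ → Λ → Λ → ℂ} (hh : ∀ a b, ∑ p, ∑ q, u p a * star (u q b) * h p q = h a b)
    (hg : ∀ a b c d,
      ∑ p, ∑ q, ∑ r, ∑ s, u p a * star (u q b) * u r c * star (u s d) * g p q r s = g a b c d)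
    (hnuc : ℂ) : Commute (Gamma (U.map star)) (molecularHamiltonian h g hnuc) := by
  have key := conjTranspose_Gamma_mul_molecularHamiltonian_mul_Gamma hU hUu h g hnuc
  have hh' : (fun a b => ∑ p, ∑ q, u p a * star (u q b) * h p q) = h :=
    funext fun a => funext fun b => hh a b
  have hg' : (fun a b c d =>
      ∑ p, ∑ q, ∑ r, ∑ s, u p a * star (u q b) * u r c * star (u s d) * g p q r s) = g :=
    funext fun a => funext fun b => funext fun c => funext fun d => hg a b c d
  rw [hh', hg'] at key
  rw [Commute, SemiconjBy]
  calc Gamma (U.map star) * molecularHamiltonian h g hnuc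
      = Gamma (U.map star) * ((Gamma (U.map star))ᴴ * molecularHamiltonian h g hnuc *
          Gamma (U.map star)) := by rw [key]
    _ = molecularHamiltonian h g hnuc * Gamma (U.map star) := by
        rw [← Matrix.mul_assoc, ← Matrix.mul_assoc,
          Gamma_mul_conjTranspose_Gamma (mapStar_mem_unitaryGroup hU), Matrix.one_mul]

/-- **The `N`-electron ground-state energy is invariant under conjugation by `Γ(V)`** for ANY unitary
`V` of the spin-orbital space (`Γ(V)` preserves the particle number): `E₀(Γ(V)† H Γ(V); N) = E₀(H; N)`
(Tasaki §2.2, variational characterisation). -/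
theorem groundEnergy_conjTranspose_Gamma_mul {ι : Type*} [LinearOrder ι] [Fintype ι] {V : Matrix ι ι ℂ}
    (hV : V ∈ Matrix.unitaryGroup ι ℂ) (H : Matrix (Finset ι) (Finset ι) ℂ) (N : ℕ) :
    Literature.MathematicalPhysics.QuantumLattice.groundEnergy ((Gamma V)ᴴ * H * Gamma V) N =
      Literature.MathematicalPhysics.QuantumLattice.groundEnergy H N := by
  rw [groundEnergy_eq_minEnergyOn _ N (nParticleSubmodule N) (mem_nParticleSubmodule_iff N),
    groundEnergy_eq_minEnergyOn H N (nParticleSubmodule N) (mem_nParticleSubmodule_iff N)]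
  refine Matrix.minEnergyOn_conjTranspose_mul_mul H (Gamma V) _ (conjTranspose_Gamma_mul_Gamma hV)
    (Gamma_mul_conjTranspose_Gamma hV) (fun ψ hψ => ?_) (fun ψ hψ => ?_)
  · rw [mem_nParticleSubmodule_iff] at hψ ⊢
    exact Summit.HubbardSuperconductivity.ColourTheSpin.SgEndpoint.isNParticle_Gamma_mulVec V hψ
  · rw [mem_nParticleSubmodule_iff] at hψ ⊢
    rw [← Gamma_conjTranspose]
    exact Summit.HubbardSuperconductivity.ColourTheSpin.SgEndpoint.isNParticle_Gamma_mulVec Vᴴ hψ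

/-- **THE FULL-CI ENERGY IS AN ORBITAL-ROTATION INVARIANT (`N`-electron form)**:
`E₀(Ĥ(h', g', h_nuc); N) = E₀(Ĥ(h, g, h_nuc); N)` for the rotated integral tables of a unitary `u`. -/
theorem groundEnergy_conj_orbital {U : Matrix (Orb Λ) (Orb Λ) ℂ} {u : Matrix Λ Λ ℂ}
    (hU : U * Uᴴ = 1) (hUu : ∀ p q σ τ, U (orb p σ) (orb q τ) = if σ = τ then u p q else 0)
    (h : Λ → Λ → ℂ) (g : Λ → Λ → Λ → Λ → ℂ) (hnuc : ℂ) (N : ℕ) :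
    Literature.MathematicalPhysics.QuantumLattice.groundEnergy
        (molecularHamiltonian (fun a b => ∑ p, ∑ q, u p a * star (u q b) * h p q)
          (fun a b c d => ∑ p, ∑ q, ∑ r, ∑ s, u p a * star (u q b) * u r c * star (u s d) * g p q r s)
          hnuc) N =
      Literature.MathematicalPhysics.QuantumLattice.groundEnergy (molecularHamiltonian h g hnuc) N := by
  rw [← conjTranspose_Gamma_mul_molecularHamiltonian_mul_Gamma hU hUu]
  exact groundEnergy_conjTranspose_Gamma_mul (mapStar_mem_unitaryGroup hU) _ N

/-- **The `(N_α, N_β)`-sector ground-state energy is invariant under conjugation by `Γ(V)`** for a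
SPIN-DIAGONAL unitary `V` (`V_{oo'} = 0` for different spins; independent `α`/`β` rotations allowed):
`Γ(V)` then commutes with `N_↑`, `N_↓` and preserves every sector. -/
theorem sectorGroundEnergy_conjTranspose_Gamma_mul {V : Matrix (Orb Λ) (Orb Λ) ℂ}
    (hV : V ∈ Matrix.unitaryGroup (Orb Λ) ℂ)
    (hspin : ∀ o o' : Orb Λ, (ofLex o).2 ≠ (ofLex o').2 → V o o' = 0)
    (H : Matrix (Finset (Orb Λ)) (Finset (Orb Λ)) ℂ) (a b : ℕ) :
    sectorGroundEnergy ((Gamma V)ᴴ * H * Gamma V) a b = sectorGroundEnergy H a b := by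
  rw [sectorGroundEnergy_def, sectorGroundEnergy_def]
  refine Matrix.minEnergyOn_conjTranspose_mul_mul H (Gamma V) _ (conjTranspose_Gamma_mul_Gamma hV)
    (Gamma_mul_conjTranspose_Gamma hV) (fun ψ hψ => ?_) (fun ψ hψ => ?_)
  · rw [mem_szSector_iff_isInSector] at hψ ⊢
    exact (Summit.HubbardSuperconductivity.HubbardSuperconductivity.Theorems.WidthHaldane.preservesSectors_Gamma
      hV hspin).isInSector_mulVec hψ
  · rw [mem_szSector_iff_isInSector] at hψ ⊢
    exact (Summit.HubbardSuperconductivity.HubbardSuperconductivity.Theorems.WidthHaldane.preservesSectors_Gamma_conjTranspose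
      hV hspin).isInSector_mulVec hψ

omit [LinearOrder Λ] [Fintype Λ] in
/-- A spin-free lift and its entrywise conjugate are spin-diagonal. -/
theorem mapStar_spin_sel_of_orbital {U : Matrix (Orb Λ) (Orb Λ) ℂ} {u : Matrix Λ Λ ℂ}
    (hUu : ∀ p q σ τ, U (orb p σ) (orb q τ) = if σ = τ then u p q else 0) (o o' : Orb Λ)
    (ho : (ofLex o).2 ≠ (ofLex o').2) : (U.map star) o o' = 0 := by
  rw [map_apply, spin_sel_of_orbital hUu o o' ho, star_zero]

/-- **THE FULL-CI SECTOR ENERGY IS AN ORBITAL-ROTATION INVARIANT**: for a unitary one-particle matrix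
`u` with spin-free lift `U`, `E₀(Ĥ(h', g', h_nuc); N_α, N_β) = E₀(Ĥ(h, g, h_nuc); N_α, N_β)` — the exact
target of every sector row depends on the integral tables only through their unitary-equivalence
class (canonical, localised or symmetry-adapted orbitals of one active space give the same number). -/
theorem sectorGroundEnergy_conj_orbital {U : Matrix (Orb Λ) (Orb Λ) ℂ} {u : Matrix Λ Λ ℂ}
    (hU : U * Uᴴ = 1) (hUu : ∀ p q σ τ, U (orb p σ) (orb q τ) = if σ = τ then u p q else 0)
    (h : Λ → Λ → ℂ) (g : Λ → Λ → Λ → Λ → ℂ) (hnuc : ℂ) (a b : ℕ) :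
    sectorGroundEnergy
        (molecularHamiltonian (fun a b => ∑ p, ∑ q, u p a * star (u q b) * h p q)
          (fun a b c d => ∑ p, ∑ q, ∑ r, ∑ s, u p a * star (u q b) * u r c * star (u s d) * g p q r s)
          hnuc) a b =
      sectorGroundEnergy (molecularHamiltonian h g hnuc) a b := by
  rw [← conjTranspose_Gamma_mul_molecularHamiltonian_mul_Gamma hU hUu]
  exact sectorGroundEnergy_conjTranspose_Gamma_mul (mapStar_mem_unitaryGroup hU)
    (mapStar_spin_sel_of_orbital hUu) _ a b

/-- **The slack of the sector DQG bound is an orbital-rotation invariant**: both the exact sector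
energy (this file) and the relaxed value `E_PQG` (`pqgSectorEnergy_conj_orbital`,
`Rows/OrbitalRotationInvariance.lean`) are invariants, hence so is their difference — the quality of
the certified lower bound of a sector row does not depend on the orbital basis of the model file. -/
theorem sectorGroundEnergy_sub_pqgSectorEnergy_conj_orbital {U : Matrix (Orb Λ) (Orb Λ) ℂ}
    {u : Matrix Λ Λ ℂ} (hU : U * Uᴴ = 1)
    (hUu : ∀ p q σ τ, U (orb p σ) (orb q τ) = if σ = τ then u p q else 0)
    (h : Λ → Λ → ℂ) (g : Λ → Λ → Λ → Λ → ℂ) (hnuc : ℂ) (a b : ℕ) :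
    sectorGroundEnergy
          (molecularHamiltonian (fun a b => ∑ p, ∑ q, u p a * star (u q b) * h p q)
            (fun a b c d => ∑ p, ∑ q, ∑ r, ∑ s, u p a * star (u q b) * u r c * star (u s d) * g p q r s)
            hnuc) a b -
        pqgSectorEnergy (fun a b => ∑ p, ∑ q, u p a * star (u q b) * h p q)
          (fun a b c d => ∑ p, ∑ q, ∑ r, ∑ s, u p a * star (u q b) * u r c * star (u s d) * g p q r s)
          hnuc a b =
      sectorGroundEnergy (molecularHamiltonian h g hnuc) a b - pqgSectorEnergy h g hnuc a b := by
  rw [sectorGroundEnergy_conj_orbital hU hUu, ← pqgSectorEnergy_conj_orbital hU hUu]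

end Consequences

end Summit.Ventures.CertifiedQuantumChemistry

end
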